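import Literature.MathematicalPhysics.QuantumFieldTheory.Balaban1983to89.B8Prop6CubeMemberGaugedBdry

/-!
# `Balaban1983to89.B8Prop6CubeMemberBdry4` — [Balaban1985RegularSpaces] PROPOSITION 6 (p. 99) AT THE CONCRETE CUBE FAMILY OF (1.131), BACKGROUND `1`,
# THE PROP.-3-FRAME b9 SOCKET IN THE REPAIRED CURRENCY REDUCED TO ITS FOUR LOCAL LINES (the Hölder line dropped)

statement-level skeleton of published theorems with citation tags; proofs where landed; nothing here is a claim about the
Yang–Mills mass gap

PDF held: `paper:balaban1985-cmp99-regular-spaces-gauge-fixing` (journal page = PDF page + 74); pp. 83, 86–88, 98–99.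
[4] = `Balaban1985BackgroundPropagators` ((3.40) p. 397: the Hölder quotient and its admissible pairs `|x − x′| ≤ 1`).

CITATION HEADER (lean-in-tree rule).  Cell `pub-ymgap` (YM Track A, HUMAN RULING D-0062), DAG node N05 = [B8], seat `pub-ymgap-dag-n05-e`
(R141 (C) fan-out, row s3b), generation g7.  WHY: this seat's g6 files `B8Prop6CubeMemberNormsBdry` (F8), `B8Prop6CubeMemberGaugedBdry`
(F9), `B8LeafKnitZd3CubBdry` (F10) carry the Prop.-3-frame b9 socket at the cube member INLINE in the repaired currency (`SB9D`: the
(1.59) lines for `G(1)`, `H(1)` on the finite cube family WITH exterior data, an exterior-collar term `+ B_∂·Φ₀(A′)` on every line) with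
FIVE lines, the fifth being the Hölder member (the p. 86 norm `|·|_(2+β)` of [4] (3.40)'s quotient over admissible pairs with first point
in `Ω_j`).  The N06 junction seat (dag-n06-b g5, bus l.18652) LOCATED that the fifth line is not suppliable uniformly in `k` at a finite
`Ω₀`: an admissible pair joins a level-`(k−1)` site to a corner site of `□₀`, so its left side carries the weight `(L^{k−1}η)^{2+β}` while
the collar allowance on the right is weighted at level `0` (lines 1–4 are local and meet the outer collar at level `0` only).  In F8–F10 the
fifth line is IDLE: `norms136_cubeMember_at_bdry` discards it (`obtain ⟨…, -⟩`), the other theorems only hand the binder down, and no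
conclusion reads the Hölder parameters (`B8.Thm4Printed` never projects `GFData.C136`).  THIS FILE lands the FOUR-LINE twins (`…_d4`) of
F8 and of F9's first two theorems: the same statements with the Hölder line REMOVED from the socket binder — a pure weakening of the
hypothesis.  Proofs: the g6 theorem at the degenerate Hölder parameters `(len, B₀(β)) := (0, 0)`, where [4] (3.40) has NO admissible pair
(`AdmPair η 0 = ∅`) and the fifth line reads `|·|_(2+β) over ∅ ≤ B_∂·Φ₀(A′)`, true; Theorem 4 as printed on the cube sub-family is moved
between Hölder parameters by `Iff.rfl`.  Kind «kernel-checked proof», theorems only, no `def`.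

HONEST SCOPE.  (i) By-name corollaries of the landed g6 theorems; the four-line socket is a HYPOTHESIS ([4] Thm 3.3 for `G(1)`, `H(1)` on
the finite cube family with exterior data — the N06 junction's object in the repaired currency), NOT discharged.  (ii) `B_∂ ≥ 0` and the
side condition `4B_∂ ≤ (dL − 1)B₀` (absorption of the collar allowance in the slack of (1.60) ⇒ (1.62), `B8Prop3KLevelBdry`) are the
tree's; with the junction's explicit `B_∂` they amount to an «`L` large» proviso — reported on the bus, not hidden.  (iii) The g6
five-line theorems stay as they are (corollaries with an idle conjunct).  Count-neutral; N05 NOT discharged; one finite `𝕋⁴` programme at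
fixed `ε`, Bałaban as printed; nothing continuum ∕ ℝ⁴ ∕ OS ∕ mass-gap ∕ Clay.  Unit `pub-ymgap-dag-n05-e` (g7), 2026-08-27.
-/

noncomputable section

open NormedSpace

namespace Literature.MathematicalPhysics.QuantumFieldTheory.Balaban1983to89.B8Prop6CubeMemberBdry4

open MatrixLog B7Prop1Explicit B7Prop2Explicit B7Prop1Local B7Eq92Concrete
open B7Prop2Explicit (C0 c2')
open B7Prop4GeneralLevels (logCovIter linCovIter)
open B8Ineq132 (covDerivFwd InAk BondTouches)
open B8Ineq133 (cutFixed)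
open B8Lemma1NonAbelian (mulCfg)
open B8Eq146AExpansion (iEta plaqCovDeriv)
open B8Eq143PlaqExpansion (pdiv)
open B8Eq184Proof (cfgExp)
open B8Eq140Level (SideTouches)
open B8Eq119TwistedAxial (InAx Restr129)
open B8Eq155JBound (Jcur wsup)
open B8ScaledSupNorm (bondNorm msup msup_le msup_nonneg)
open B8Eq138LandauZd (IsLandau138W logCfg covLap)
open B8Eq131Cubes (tcube tLo tHi ctr)
open B8Eq131CubesAdmissible (cubeFam)
open B8CubeMemberZd (cubeLamS cubeLamB)
open B8LeafModelZd (ZdIdx)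
open B8LeafModelZd3 (mlogCfg zdGF3)
open B9Eq340HolderZd (hquot AdmPair)
open Node00 (CubeB8 GaugedBoundB8 zdCub prop6Printed_zdCub_iff)

-- `Site` alone could resolve to the torus sites of `Setup.lean`; re-export the `ℤ^d` sites of `B7Prop1Explicit`.
export B7Prop1Explicit (Site)

variable {d : ℕ}

variable {𝔸 : Type} [CStarAlgebra 𝔸] [Nontrivial 𝔸]

/-! ## §0 Two kernel facts about the Hölder line, one about Theorem 4 as printed -/

/-- [4] (3.40)'s admissible pairs `{(x, x′) : 0 < |x′ − x|, η|x′ − x| ≤ 1}` for the degenerate length function `len = 0`: there is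
NONE (the quotient family of the Hölder norm is empty). [cite: Balaban1985BackgroundPropagators, (3.40) p.397] -/
theorem not_mem_admPair_zero (η : ℝ) (p : Site d × Site d) : p ∉ AdmPair η (fun _ => (0 : ℝ)) := by
  intro h
  exact (lt_irrefl (0 : ℝ)) h.1

/-- **The Hölder line of the repaired (1.59) socket at the degenerate parameters `len = 0`, `B₀(β) = 0` is trivial**: its left side is
the p. 86 norm `|·|_(2+β)` of a family indexed by admissible pairs, of which there is none, so it is `≤` any non-negative right side —
here `0·X + R` with `R = B_∂·Φ₀(A′) ≥ 0`.  (Why the fifth line of the g6 binder `SB9D` can be dropped at no cost.)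
[cite: Balaban1985RegularSpaces, (1.59) p.86; Balaban1985BackgroundPropagators, (3.40) p.397] -/
theorem holderLine_trivial {ι : Type} (L k : ℕ) {η : ℝ} (_hη : 0 ≤ η) (β : ℝ) (P : ℕ → ι → Prop) (sel : ι → Site d × Site d)
    (F : ι → ℝ) {X R : ℝ} (hR : 0 ≤ R) :
    msup L k η (-(2 + β)) (fun j (q : ι) => sel q ∈ AdmPair η (fun _ => (0 : ℝ)) ∧ P j q) F ≤ 0 * X + R := by
  rw [zero_mul, zero_add]
  exact msup_le hR (fun j _ q hq => absurd hq.1 (not_mem_admPair_zero η (sel q)))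

omit [Nontrivial 𝔸] in
/-- **THEOREM 4 AS PRINTED on the cube sub-family of n05-a's `zdGF3` carriers DOES NOT READ THE HÖLDER PARAMETERS** `(β, len)`: the
printed sentence `B8.Thm4Printed` (p. 88) quantifies the carrier's `InA`, `Reg335`, `InAAx`, `avgClose166`, `Restricted`, `act`, `C137`,
`Landau`, `C162` and never the (1.36)-predicate `C136` — the only field of `zdGF3 𝔸 L β len i` in which `β`, `len` occur — so the two
sentences are one term (`Iff.rfl`). [cite: Balaban1985RegularSpaces, Thm 4 (1.67) p.88, (1.36) p.83] -/
theorem thm4Printed_zdCubFam_holderIrrel {L : ℕ} (B β β' : ℝ) (len len' : Site d → ℝ) :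
    B8.Thm4Printed B
      (fun i : {i : ZdIdx d L // ∃ (a : Site d) (M ρ : ℕ), L ≤ ρ ∧ ρ ≤ M ∧ 11 * d < M ∧ L ≤ d * M ∧
        i.Ω = cubeFam false L a M ρ i.k ∧ i.Λs = cubeLamS L a M ρ i.k ∧ i.Λb = cubeLamB L a M ρ i.k} => (zdGF3 𝔸 L β len i.1).toGFData) ↔
    B8.Thm4Printed B
      (fun i : {i : ZdIdx d L // ∃ (a : Site d) (M ρ : ℕ), L ≤ ρ ∧ ρ ≤ M ∧ 11 * d < M ∧ L ≤ d * M ∧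
        i.Ω = cubeFam false L a M ρ i.k ∧ i.Λs = cubeLamS L a M ρ i.k ∧ i.Λb = cubeLamB L a M ρ i.k} => (zdGF3 𝔸 L β' len' i.1).toGFData) :=
  Iff.rfl

/-! ## §1 Proposition 3's norm members at the cube member from the FOUR-LINE repaired socket -/

/-- **PROPOSITION 3 (p. 87) AT THE CONCRETE CUBE MEMBER, BACKGROUND `1`: THE NORM MEMBERS OF (1.136) FROM THE FOUR-LINE b9 SOCKET IN THE
REPAIRED CURRENCY** — this seat's g6 `B8Prop6CubeMemberNormsBdry.norms136_cubeMember_at_bdry` with the Hölder line REMOVED from the inline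
socket binder (lines 1–4 kept verbatim: `|A′|_(−1)`, `|∇A′|_(−2)`, `|∂*∂A′|_(−3)`, `|ΔA′|_(−3)` on the touching bonds, each
`≤ B₀(|J|_(−3) + |B₁|) + B_∂·Φ₀(A′)`), the support clause «`u = 1` off `□₀`», and the side conditions `0 ≤ B_∂`, `4B_∂ ≤ (dL − 1)B₀`; SAME
constants `5dLB₀·s` for the three concluded members.  Proof: the g6 theorem at Hölder parameters `(β, len, B₀(β)) := (0, 0, 0)`, where the
fifth line is `holderLine_trivial`. [cite: Balaban1985RegularSpaces, Prop. 3 p.87, Prop. 6 (1.136) p.99, (1.58)–(1.61) p.86, (1.133) p.99] -/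
theorem norms136_cubeMember_at_bdry_d4 (hd2 : 2 ≤ d) {L : ℕ} (hL : 2 ≤ L) {B₀ C₂ cB9 Bbd : ℝ} (hB₀ : 0 < B₀)
    (hC₂ : 2097152 * ((d : ℝ) + 1) ^ 2 ≤ C₂) (hcB9 : 0 < cB9) (hBbd : 0 ≤ Bbd) (hBd : 4 * Bbd ≤ ((d : ℝ) * L - 1) * B₀) :
    ∃ c : ℝ, 0 < c ∧ ∀ (η : ℝ), 0 < η → ∀ (k : ℕ), 1 ≤ k → ∀ (a : Site d) (M ρ : ℕ), L ≤ ρ → ρ ≤ M → 11 * (d : ℝ) < M →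
      -- the Prop.-3-frame b9 socket AT THE MEMBER, IN THE REPAIRED CURRENCY — FOUR LINES (exterior-collar term on every line; no Hölder line)
      (∀ α₀ α₂ : ℝ, 0 < α₀ → α₀ ≤ cB9 → 0 < α₂ → α₂ ≤ cB9 →
      ∀ (U₀ W : Site d → Fin d → 𝔸ˣ), (∀ x κ, U₀ x κ ∈ unitaryUnits 𝔸) → (∀ x κ, W x κ ∈ unitaryUnits 𝔸) →
      InAk L k η α₀ (cubeFam false L a M ρ k) U₀ → InAk L k η α₀ (cubeFam false L a M ρ k) (mulCfg W U₀) → IsLandau138W L k η ((cubeFam false L a M ρ k) 0) (cubeLamS L a M ρ k k) U₀ W →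
      ∀ A' : Site d → Fin d → 𝔸, (∀ y τ, IsSelfAdjoint (A' y τ)) →
      (∀ j, j ≤ k → ∀ (y : Site d) (τ : Fin d), SideTouches ((cubeFam false L a M ρ k) j) y τ →
      W y τ = cfgExp η A' y τ ∧ ‖A' y τ‖ ≤ α₂ * ((L : ℝ) ^ j * η)⁻¹) →
      (∀ (y : Site d) (τ : Fin d), (∀ j, j ≤ k → ¬ SideTouches ((cubeFam false L a M ρ k) j) y τ) → A' y τ = 0) →
      msup L k η (-(1 : ℝ)) (fun j (b : Site d × Fin d) => SideTouches ((cubeFam false L a M ρ k) j) b.1 b.2) (fun b => A' b.1 b.2)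
      ≤ B₀ * (bondNorm L k η (-(3 : ℝ)) (cubeFam false L a M ρ k) (fun x μ => Jcur η U₀ A' μ x)
      + wsup 1 (fun p : {p : ℕ × (Site d × Fin d) // p.1 ≤ k ∧ p.2 ∈ cubeLamB L a M ρ k k p.1} =>
      linCovIter L U₀ (iEta η A') p.1.1 p.1.2.1 p.1.2.2)) + Bbd * msup L k η (-(1 : ℝ))
      (fun j (b : Site d × Fin d) => j = 0 ∧ SideTouches ((cubeFam false L a M ρ k) 0) b.1 b.2 ∧ ¬ BondTouches ((cubeFam false L a M ρ k) 0) b.1 b.2)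
      (fun b => A' b.1 b.2) ∧
      msup L k η (-(2 : ℝ)) (fun j (t : Fin d × Fin d × Site d) => SideTouches ((cubeFam false L a M ρ k) j) t.2.2 t.2.1)
      (fun t => covDerivFwd η U₀ t.1 (fun z => A' z t.2.1) t.2.2)
      ≤ B₀ * (bondNorm L k η (-(3 : ℝ)) (cubeFam false L a M ρ k) (fun x μ => Jcur η U₀ A' μ x)
      + wsup 1 (fun p : {p : ℕ × (Site d × Fin d) // p.1 ≤ k ∧ p.2 ∈ cubeLamB L a M ρ k k p.1} =>
      linCovIter L U₀ (iEta η A') p.1.1 p.1.2.1 p.1.2.2)) + Bbd * msup L k η (-(1 : ℝ))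
      (fun j (b : Site d × Fin d) => j = 0 ∧ SideTouches ((cubeFam false L a M ρ k) 0) b.1 b.2 ∧ ¬ BondTouches ((cubeFam false L a M ρ k) 0) b.1 b.2)
      (fun b => A' b.1 b.2) ∧
      bondNorm L k η (-(3 : ℝ)) (cubeFam false L a M ρ k) (fun x μ => pdiv η U₀ (plaqCovDeriv η U₀ A') μ x)
      ≤ B₀ * (bondNorm L k η (-(3 : ℝ)) (cubeFam false L a M ρ k) (fun x μ => Jcur η U₀ A' μ x)
      + wsup 1 (fun p : {p : ℕ × (Site d × Fin d) // p.1 ≤ k ∧ p.2 ∈ cubeLamB L a M ρ k k p.1} =>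
      linCovIter L U₀ (iEta η A') p.1.1 p.1.2.1 p.1.2.2)) + Bbd * msup L k η (-(1 : ℝ))
      (fun j (b : Site d × Fin d) => j = 0 ∧ SideTouches ((cubeFam false L a M ρ k) 0) b.1 b.2 ∧ ¬ BondTouches ((cubeFam false L a M ρ k) 0) b.1 b.2)
      (fun b => A' b.1 b.2) ∧
      bondNorm L k η (-(3 : ℝ)) (cubeFam false L a M ρ k) (fun x μ => covLap η U₀ (fun z => A' z μ) x)
      ≤ B₀ * (bondNorm L k η (-(3 : ℝ)) (cubeFam false L a M ρ k) (fun x μ => Jcur η U₀ A' μ x)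
      + wsup 1 (fun p : {p : ℕ × (Site d × Fin d) // p.1 ≤ k ∧ p.2 ∈ cubeLamB L a M ρ k k p.1} =>
      linCovIter L U₀ (iEta η A') p.1.1 p.1.2.1 p.1.2.2)) + Bbd * msup L k η (-(1 : ℝ))
      (fun j (b : Site d × Fin d) => j = 0 ∧ SideTouches ((cubeFam false L a M ρ k) 0) b.1 b.2 ∧ ¬ BondTouches ((cubeFam false L a M ρ k) 0) b.1 b.2)
      (fun b => A' b.1 b.2)) →
      ∀ (U₀ : Site d → Fin d → 𝔸ˣ), (∀ x κ, U₀ x κ ∈ unitaryUnits 𝔸) → ∀ (α₀ : ℝ), 0 < α₀ →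
      C0 d * (α₀ * (L : ℝ) ^ 2) ≤ 1 / 3 → 2 * (α₀ * (L : ℝ) ^ 2) ≤ c2' d L →
      ∀ (Ω : ℕ → Set (Site d)), InAk L k η α₀ Ω U₀ → tcube L a M ρ k ⊆ Ω (k - 1) →
      11 * (d : ℝ) ^ 2 * (L : ℝ) ^ 2 * α₀ + ((M : ℝ) + 4 * ρ) * d * (L : ℝ) ^ 2 * α₀ ≤ 1 / 6 →
      (L : ℝ) ^ 3 * α₀ ≤ c → 5 * (d : ℝ) * L * B₀ * ((L : ℝ) ^ 3 * α₀ + 6 * d * (L : ℝ) ^ 2 * M * α₀) ≤ c →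
      2 * (5 * (d : ℝ) * L * B₀ * ((L : ℝ) ^ 3 * α₀ + 6 * d * (L : ℝ) ^ 2 * M * α₀)) ^ 2
        + 20 * d * ((L : ℝ) ^ 3 * α₀) * (5 * (d : ℝ) * L * B₀ * ((L : ℝ) ^ 3 * α₀ + 6 * d * (L : ℝ) ^ 2 * M * α₀))
        + 2 * C₂ * (5 * (d : ℝ) * L * B₀ * ((L : ℝ) ^ 3 * α₀ + 6 * d * (L : ℝ) ^ 2 * M * α₀)) ^ 2
        ≤ (L : ℝ) ^ 3 * α₀ + 6 * d * (L : ℝ) ^ 2 * M * α₀ →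
      (d : ℝ) * L * (6 * d * (L : ℝ) ^ 2 * M * α₀) ≤ 1 / 8 →
      ∀ (u : Site d → 𝔸ˣ), (∀ x, u x ∈ unitaryUnits 𝔸) → (∀ x, x ∉ cubeFam false L a M ρ k 0 → u x = 1) →
      Restr129 L k (cubeLamS L a M ρ k k) (1 : Site d → Fin d → 𝔸ˣ) u →
      IsLandau138W L k η (cubeFam false L a M ρ k 0) (cubeLamS L a M ρ k k) (1 : Site d → Fin d → 𝔸ˣ)
        (gaugeAct u⁻¹ (cutFixed L (tLo a ρ) (tHi a M ρ) U₀ k (ctr a M))) →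
      (∀ j, j ≤ k → ∀ b ∈ {b : Site d × Fin d | SideTouches (cubeFam false L a M ρ k j) b.1 b.2},
        gaugeAct u⁻¹ (cutFixed L (tLo a ρ) (tHi a M ρ) U₀ k (ctr a M)) b.1 b.2 =
            cfgExp η (logCfg η (gaugeAct u⁻¹ (cutFixed L (tLo a ρ) (tHi a M ρ) U₀ k (ctr a M)))) b.1 b.2 ∧
          IsSelfAdjoint (logCfg η (gaugeAct u⁻¹ (cutFixed L (tLo a ρ) (tHi a M ρ) U₀ k (ctr a M))) b.1 b.2) ∧
          ‖logCfg η (gaugeAct u⁻¹ (cutFixed L (tLo a ρ) (tHi a M ρ) U₀ k (ctr a M))) b.1 b.2‖ ≤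
            (5 * (d : ℝ) * L * B₀ * ((L : ℝ) ^ 3 * α₀ + 6 * d * (L : ℝ) ^ 2 * M * α₀)) * ((L : ℝ) ^ j * η)⁻¹) →
      msup L k η (-(2 : ℝ)) (fun j (t : Fin d × Fin d × Site d) => SideTouches (cubeFam false L a M ρ k j) t.2.2 t.2.1)
          (fun t => covDerivFwd η (1 : Site d → Fin d → 𝔸ˣ) t.1 (fun z => mlogCfg k η (cubeFam false L a M ρ k)
            (gaugeAct u⁻¹ (cutFixed L (tLo a ρ) (tHi a M ρ) U₀ k (ctr a M))) z t.2.1) t.2.2)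
        ≤ 5 * (d : ℝ) * L * B₀ * ((L : ℝ) ^ 3 * α₀ + 6 * d * (L : ℝ) ^ 2 * M * α₀) ∧
      bondNorm L k η (-(3 : ℝ)) (cubeFam false L a M ρ k) (fun x μ => pdiv η (1 : Site d → Fin d → 𝔸ˣ)
          (plaqCovDeriv η (1 : Site d → Fin d → 𝔸ˣ) (mlogCfg k η (cubeFam false L a M ρ k)
            (gaugeAct u⁻¹ (cutFixed L (tLo a ρ) (tHi a M ρ) U₀ k (ctr a M))))) μ x)
        ≤ 5 * (d : ℝ) * L * B₀ * ((L : ℝ) ^ 3 * α₀ + 6 * d * (L : ℝ) ^ 2 * M * α₀) ∧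
      bondNorm L k η (-(3 : ℝ)) (cubeFam false L a M ρ k) (fun x μ => covLap η (1 : Site d → Fin d → 𝔸ˣ)
          (fun z => mlogCfg k η (cubeFam false L a M ρ k) (gaugeAct u⁻¹ (cutFixed L (tLo a ρ) (tHi a M ρ) U₀ k (ctr a M))) z μ) x)
        ≤ 5 * (d : ℝ) * L * B₀ * ((L : ℝ) ^ 3 * α₀ + 6 * d * (L : ℝ) ^ 2 * M * α₀) := by
  obtain ⟨c, hc, N⟩ := B8Prop6CubeMemberNormsBdry.norms136_cubeMember_at_bdry (𝔸 := 𝔸) hd2 hL (B₀β := 0) hB₀ hC₂ hcB9 hBbd hBd 0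
    (fun _ => (0 : ℝ))
  refine ⟨c, hc, ?_⟩
  intro η hη k hk a M ρ hρL hρM hM SB9D₄
  refine N η hη k hk a M ρ hρL hρM hM ?_
  intro α₀ α₂ hα₀ hα₀c hα₂ hα₂c U₀ W hU₀ hW hA hAW hLan A' hsa hexp hoff
  obtain ⟨l₁, l₂, l₃, l₄⟩ := SB9D₄ α₀ α₂ hα₀ hα₀c hα₂ hα₂c U₀ W hU₀ hW hA hAW hLan A' hsa hexp hoff
  exact ⟨l₁, l₂, l₃, l₄, holderLine_trivial L k hη.le 0 _ _ _ (mul_nonneg hBbd (msup_nonneg L k hη.le _ _ _))⟩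

#print axioms norms136_cubeMember_at_bdry_d4

/-! ## §2 (1.135)–(1.138) at every cube from Theorem 4 as printed on the cube sub-family + the FOUR-LINE repaired socket at the cube -/

/-- **PROPOSITION 6 (p. 99), (1.135)–(1.138) AS `Node00.GaugedBoundB8` AT EVERY CUBE, FROM THEOREM 4 AS PRINTED ON THE CUBE SUB-FAMILY AND
THE FOUR-LINE PROP.-3-FRAME b9 SOCKET AT THE CUBE IN THE REPAIRED CURRENCY** — this seat's g6
`B8Prop6CubeMemberGaugedBdry.gaugedBoundB8_cubeMember_of_thm4_b9D` with the Hölder line REMOVED from the socket binder.  `H4` is Theorem 4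
as printed on the cube sub-family at the caller's Hölder parameters `(β, len)`; it is moved to `len = 0` by
`thm4Printed_zdCubFam_holderIrrel`, and the g6 theorem is applied at `(len, B₀(β)) := (0, 0)`, the fifth line being `holderLine_trivial`.
[cite: Balaban1985RegularSpaces, Prop. 6 (1.135)–(1.138) p.99, Thm 4 p.88, Prop. 3 p.87, (1.58)–(1.59) p.86] -/
theorem gaugedBoundB8_cubeMember_of_thm4_b9D_d4 (hd2 : 2 ≤ d) {L : ℕ} (hL : 2 ≤ L) (inp : B8.B9Inputs) {C₂ cB9 Bbd : ℝ}
    (hC₂ : 2097152 * ((d : ℝ) + 1) ^ 2 ≤ C₂) (hcB9 : 0 < cB9) (hBbd : 0 ≤ Bbd) (hBd : 4 * Bbd ≤ ((d : ℝ) * L - 1) * inp.B₀)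
    (β : ℝ) (len : Site d → ℝ)
    (H4 : B8.Thm4Printed (5 * (d : ℝ) * L * inp.B₀)
      (fun i : {i : ZdIdx d L // ∃ (a : Site d) (M ρ : ℕ), L ≤ ρ ∧ ρ ≤ M ∧ 11 * d < M ∧ L ≤ d * M ∧
        i.Ω = cubeFam false L a M ρ i.k ∧ i.Λs = cubeLamS L a M ρ i.k ∧ i.Λb = cubeLamB L a M ρ i.k} => (zdGF3 𝔸 L β len i.1).toGFData)) :
    ∃ c₁ : ℝ, 0 < c₁ ∧ ∀ (η : ℝ), 0 < η → ∀ {K : ℕ} {Ω : ℕ → Set (Site d)} (c : CubeB8 d L K Ω),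
      -- the Prop.-3-frame b9 socket AT THE CUBE, IN THE REPAIRED CURRENCY — FOUR LINES (constants `inp.B₀`, `cB9`, `Bbd`; no Hölder line)
      (∀ α₀ α₂ : ℝ, 0 < α₀ → α₀ ≤ cB9 → 0 < α₂ → α₂ ≤ cB9 →
      ∀ (U₀ W : Site d → Fin d → 𝔸ˣ), (∀ x κ, U₀ x κ ∈ unitaryUnits 𝔸) → (∀ x κ, W x κ ∈ unitaryUnits 𝔸) →
      InAk L c.k η α₀ (cubeFam false L c.a c.M c.ρ c.k) U₀ → InAk L c.k η α₀ (cubeFam false L c.a c.M c.ρ c.k) (mulCfg W U₀) → IsLandau138W L c.k η ((cubeFam false L c.a c.M c.ρ c.k) 0) (cubeLamS L c.a c.M c.ρ c.k c.k) U₀ W →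
      ∀ A' : Site d → Fin d → 𝔸, (∀ y τ, IsSelfAdjoint (A' y τ)) →
      (∀ j, j ≤ c.k → ∀ (y : Site d) (τ : Fin d), SideTouches ((cubeFam false L c.a c.M c.ρ c.k) j) y τ →
      W y τ = cfgExp η A' y τ ∧ ‖A' y τ‖ ≤ α₂ * ((L : ℝ) ^ j * η)⁻¹) →
      (∀ (y : Site d) (τ : Fin d), (∀ j, j ≤ c.k → ¬ SideTouches ((cubeFam false L c.a c.M c.ρ c.k) j) y τ) → A' y τ = 0) →
      msup L c.k η (-(1 : ℝ)) (fun j (b : Site d × Fin d) => SideTouches ((cubeFam false L c.a c.M c.ρ c.k) j) b.1 b.2) (fun b => A' b.1 b.2)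
      ≤ inp.B₀ * (bondNorm L c.k η (-(3 : ℝ)) (cubeFam false L c.a c.M c.ρ c.k) (fun x μ => Jcur η U₀ A' μ x)
      + wsup 1 (fun p : {p : ℕ × (Site d × Fin d) // p.1 ≤ c.k ∧ p.2 ∈ cubeLamB L c.a c.M c.ρ c.k c.k p.1} =>
      linCovIter L U₀ (iEta η A') p.1.1 p.1.2.1 p.1.2.2)) + Bbd * msup L c.k η (-(1 : ℝ))
      (fun j (b : Site d × Fin d) => j = 0 ∧ SideTouches ((cubeFam false L c.a c.M c.ρ c.k) 0) b.1 b.2 ∧ ¬ BondTouches ((cubeFam false L c.a c.M c.ρ c.k) 0) b.1 b.2)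
      (fun b => A' b.1 b.2) ∧
      msup L c.k η (-(2 : ℝ)) (fun j (t : Fin d × Fin d × Site d) => SideTouches ((cubeFam false L c.a c.M c.ρ c.k) j) t.2.2 t.2.1)
      (fun t => covDerivFwd η U₀ t.1 (fun z => A' z t.2.1) t.2.2)
      ≤ inp.B₀ * (bondNorm L c.k η (-(3 : ℝ)) (cubeFam false L c.a c.M c.ρ c.k) (fun x μ => Jcur η U₀ A' μ x)
      + wsup 1 (fun p : {p : ℕ × (Site d × Fin d) // p.1 ≤ c.k ∧ p.2 ∈ cubeLamB L c.a c.M c.ρ c.k c.k p.1} =>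
      linCovIter L U₀ (iEta η A') p.1.1 p.1.2.1 p.1.2.2)) + Bbd * msup L c.k η (-(1 : ℝ))
      (fun j (b : Site d × Fin d) => j = 0 ∧ SideTouches ((cubeFam false L c.a c.M c.ρ c.k) 0) b.1 b.2 ∧ ¬ BondTouches ((cubeFam false L c.a c.M c.ρ c.k) 0) b.1 b.2)
      (fun b => A' b.1 b.2) ∧
      bondNorm L c.k η (-(3 : ℝ)) (cubeFam false L c.a c.M c.ρ c.k) (fun x μ => pdiv η U₀ (plaqCovDeriv η U₀ A') μ x)
      ≤ inp.B₀ * (bondNorm L c.k η (-(3 : ℝ)) (cubeFam false L c.a c.M c.ρ c.k) (fun x μ => Jcur η U₀ A' μ x)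
      + wsup 1 (fun p : {p : ℕ × (Site d × Fin d) // p.1 ≤ c.k ∧ p.2 ∈ cubeLamB L c.a c.M c.ρ c.k c.k p.1} =>
      linCovIter L U₀ (iEta η A') p.1.1 p.1.2.1 p.1.2.2)) + Bbd * msup L c.k η (-(1 : ℝ))
      (fun j (b : Site d × Fin d) => j = 0 ∧ SideTouches ((cubeFam false L c.a c.M c.ρ c.k) 0) b.1 b.2 ∧ ¬ BondTouches ((cubeFam false L c.a c.M c.ρ c.k) 0) b.1 b.2)
      (fun b => A' b.1 b.2) ∧
      bondNorm L c.k η (-(3 : ℝ)) (cubeFam false L c.a c.M c.ρ c.k) (fun x μ => covLap η U₀ (fun z => A' z μ) x)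
      ≤ inp.B₀ * (bondNorm L c.k η (-(3 : ℝ)) (cubeFam false L c.a c.M c.ρ c.k) (fun x μ => Jcur η U₀ A' μ x)
      + wsup 1 (fun p : {p : ℕ × (Site d × Fin d) // p.1 ≤ c.k ∧ p.2 ∈ cubeLamB L c.a c.M c.ρ c.k c.k p.1} =>
      linCovIter L U₀ (iEta η A') p.1.1 p.1.2.1 p.1.2.2)) + Bbd * msup L c.k η (-(1 : ℝ))
      (fun j (b : Site d × Fin d) => j = 0 ∧ SideTouches ((cubeFam false L c.a c.M c.ρ c.k) 0) b.1 b.2 ∧ ¬ BondTouches ((cubeFam false L c.a c.M c.ρ c.k) 0) b.1 b.2)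
      (fun b => A' b.1 b.2)) →
      ∀ (U₀ : Site d → Fin d → 𝔸ˣ), (∀ x κ, U₀ x κ ∈ unitaryUnits 𝔸) → ∀ (α₀ : ℝ), 0 < α₀ → InAk L K η α₀ Ω U₀ →
      7 * d * (L : ℝ) ^ 2 * c.M * α₀ ≤ c₁ →
      GaugedBoundB8 L η U₀ c (7 * d * (L : ℝ) ^ 2 * (5 * (d : ℝ) * L * inp.B₀) * c.M * α₀) := by
  obtain ⟨c₁, hc₁, G⟩ := B8Prop6CubeMemberGaugedBdry.gaugedBoundB8_cubeMember_of_thm4_b9D (𝔸 := 𝔸) hd2 hL inp (B₀β := 0) hC₂ hcB9 hBbd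
    hBd β (fun _ => (0 : ℝ)) ((thm4Printed_zdCubFam_holderIrrel (𝔸 := 𝔸) (5 * (d : ℝ) * L * inp.B₀) β β len (fun _ => (0 : ℝ))).1 H4)
  refine ⟨c₁, hc₁, ?_⟩
  intro η hη K Ω c SB9D₄
  refine G η hη c ?_
  intro α₀ α₂ hα₀ hα₀c hα₂ hα₂c U₀ W hU₀ hW hA hAW hLan A' hsa hexp hoff
  obtain ⟨l₁, l₂, l₃, l₄⟩ := SB9D₄ α₀ α₂ hα₀ hα₀c hα₂ hα₂c U₀ W hU₀ hW hA hAW hLan A' hsa hexp hoff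
  exact ⟨l₁, l₂, l₃, l₄, holderLine_trivial L c.k hη.le β _ _ _ (mul_nonneg hBbd (msup_nonneg L c.k hη.le _ _ _))⟩

#print axioms gaugedBoundB8_cubeMember_of_thm4_b9D_d4

/-- **`B8.Prop6Printed d L (5dL·inp.B₀) c₁` ON `Node00.zdCub`, FROM THEOREM 4 AS PRINTED ON THE CUBE SUB-FAMILY AND THE FOUR-LINE
REPAIRED Prop.-3-FRAME b9 SOCKET AT EVERY CUBE** (`gaugedBoundB8_cubeMember_of_thm4_b9D_d4` through `Node00.prop6Printed_zdCub_iff`; twin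
of the g6 `prop6Printed_zdCub_of_thm4_b9D`). [cite: Balaban1985RegularSpaces, Prop. 6 p.99, Thm 4 p.88, Prop. 3 p.87, (1.59) p.86] -/
theorem prop6Printed_zdCub_of_thm4_b9D_d4 (hd2 : 2 ≤ d) {L : ℕ} (hL : 2 ≤ L) (inp : B8.B9Inputs) {C₂ cB9 Bbd : ℝ}
    (hC₂ : 2097152 * ((d : ℝ) + 1) ^ 2 ≤ C₂) (hcB9 : 0 < cB9) (hBbd : 0 ≤ Bbd) (hBd : 4 * Bbd ≤ ((d : ℝ) * L - 1) * inp.B₀)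
    (β : ℝ) (len : Site d → ℝ)
    (H4 : B8.Thm4Printed (5 * (d : ℝ) * L * inp.B₀)
      (fun i : {i : ZdIdx d L // ∃ (a : Site d) (M ρ : ℕ), L ≤ ρ ∧ ρ ≤ M ∧ 11 * d < M ∧ L ≤ d * M ∧
        i.Ω = cubeFam false L a M ρ i.k ∧ i.Λs = cubeLamS L a M ρ i.k ∧ i.Λb = cubeLamB L a M ρ i.k} => (zdGF3 𝔸 L β len i.1).toGFData)) :
    ∃ c₁ : ℝ, 0 < c₁ ∧ ∀ {ι : Type} (f : ι → ZdIdx d L),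
      (∀ (jf : ι) (c : CubeB8 d L (f jf).k (f jf).Ω),
      (∀ α₀ α₂ : ℝ, 0 < α₀ → α₀ ≤ cB9 → 0 < α₂ → α₂ ≤ cB9 →
      ∀ (U₀ W : Site d → Fin d → 𝔸ˣ), (∀ x κ, U₀ x κ ∈ unitaryUnits 𝔸) → (∀ x κ, W x κ ∈ unitaryUnits 𝔸) →
      InAk L c.k (f jf).η α₀ (cubeFam false L c.a c.M c.ρ c.k) U₀ → InAk L c.k (f jf).η α₀ (cubeFam false L c.a c.M c.ρ c.k) (mulCfg W U₀) → IsLandau138W L c.k (f jf).η ((cubeFam false L c.a c.M c.ρ c.k) 0) (cubeLamS L c.a c.M c.ρ c.k c.k) U₀ W →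
      ∀ A' : Site d → Fin d → 𝔸, (∀ y τ, IsSelfAdjoint (A' y τ)) →
      (∀ j, j ≤ c.k → ∀ (y : Site d) (τ : Fin d), SideTouches ((cubeFam false L c.a c.M c.ρ c.k) j) y τ →
      W y τ = cfgExp (f jf).η A' y τ ∧ ‖A' y τ‖ ≤ α₂ * ((L : ℝ) ^ j * (f jf).η)⁻¹) →
      (∀ (y : Site d) (τ : Fin d), (∀ j, j ≤ c.k → ¬ SideTouches ((cubeFam false L c.a c.M c.ρ c.k) j) y τ) → A' y τ = 0) →
      msup L c.k (f jf).η (-(1 : ℝ)) (fun j (b : Site d × Fin d) => SideTouches ((cubeFam false L c.a c.M c.ρ c.k) j) b.1 b.2) (fun b => A' b.1 b.2)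
      ≤ inp.B₀ * (bondNorm L c.k (f jf).η (-(3 : ℝ)) (cubeFam false L c.a c.M c.ρ c.k) (fun x μ => Jcur (f jf).η U₀ A' μ x)
      + wsup 1 (fun p : {p : ℕ × (Site d × Fin d) // p.1 ≤ c.k ∧ p.2 ∈ cubeLamB L c.a c.M c.ρ c.k c.k p.1} =>
      linCovIter L U₀ (iEta (f jf).η A') p.1.1 p.1.2.1 p.1.2.2)) + Bbd * msup L c.k (f jf).η (-(1 : ℝ))
      (fun j (b : Site d × Fin d) => j = 0 ∧ SideTouches ((cubeFam false L c.a c.M c.ρ c.k) 0) b.1 b.2 ∧ ¬ BondTouches ((cubeFam false L c.a c.M c.ρ c.k) 0) b.1 b.2)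
      (fun b => A' b.1 b.2) ∧
      msup L c.k (f jf).η (-(2 : ℝ)) (fun j (t : Fin d × Fin d × Site d) => SideTouches ((cubeFam false L c.a c.M c.ρ c.k) j) t.2.2 t.2.1)
      (fun t => covDerivFwd (f jf).η U₀ t.1 (fun z => A' z t.2.1) t.2.2)
      ≤ inp.B₀ * (bondNorm L c.k (f jf).η (-(3 : ℝ)) (cubeFam false L c.a c.M c.ρ c.k) (fun x μ => Jcur (f jf).η U₀ A' μ x)
      + wsup 1 (fun p : {p : ℕ × (Site d × Fin d) // p.1 ≤ c.k ∧ p.2 ∈ cubeLamB L c.a c.M c.ρ c.k c.k p.1} =>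
      linCovIter L U₀ (iEta (f jf).η A') p.1.1 p.1.2.1 p.1.2.2)) + Bbd * msup L c.k (f jf).η (-(1 : ℝ))
      (fun j (b : Site d × Fin d) => j = 0 ∧ SideTouches ((cubeFam false L c.a c.M c.ρ c.k) 0) b.1 b.2 ∧ ¬ BondTouches ((cubeFam false L c.a c.M c.ρ c.k) 0) b.1 b.2)
      (fun b => A' b.1 b.2) ∧
      bondNorm L c.k (f jf).η (-(3 : ℝ)) (cubeFam false L c.a c.M c.ρ c.k) (fun x μ => pdiv (f jf).η U₀ (plaqCovDeriv (f jf).η U₀ A') μ x)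
      ≤ inp.B₀ * (bondNorm L c.k (f jf).η (-(3 : ℝ)) (cubeFam false L c.a c.M c.ρ c.k) (fun x μ => Jcur (f jf).η U₀ A' μ x)
      + wsup 1 (fun p : {p : ℕ × (Site d × Fin d) // p.1 ≤ c.k ∧ p.2 ∈ cubeLamB L c.a c.M c.ρ c.k c.k p.1} =>
      linCovIter L U₀ (iEta (f jf).η A') p.1.1 p.1.2.1 p.1.2.2)) + Bbd * msup L c.k (f jf).η (-(1 : ℝ))
      (fun j (b : Site d × Fin d) => j = 0 ∧ SideTouches ((cubeFam false L c.a c.M c.ρ c.k) 0) b.1 b.2 ∧ ¬ BondTouches ((cubeFam false L c.a c.M c.ρ c.k) 0) b.1 b.2)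
      (fun b => A' b.1 b.2) ∧
      bondNorm L c.k (f jf).η (-(3 : ℝ)) (cubeFam false L c.a c.M c.ρ c.k) (fun x μ => covLap (f jf).η U₀ (fun z => A' z μ) x)
      ≤ inp.B₀ * (bondNorm L c.k (f jf).η (-(3 : ℝ)) (cubeFam false L c.a c.M c.ρ c.k) (fun x μ => Jcur (f jf).η U₀ A' μ x)
      + wsup 1 (fun p : {p : ℕ × (Site d × Fin d) // p.1 ≤ c.k ∧ p.2 ∈ cubeLamB L c.a c.M c.ρ c.k c.k p.1} =>
      linCovIter L U₀ (iEta (f jf).η A') p.1.1 p.1.2.1 p.1.2.2)) + Bbd * msup L c.k (f jf).η (-(1 : ℝ))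
      (fun j (b : Site d × Fin d) => j = 0 ∧ SideTouches ((cubeFam false L c.a c.M c.ρ c.k) 0) b.1 b.2 ∧ ¬ BondTouches ((cubeFam false L c.a c.M c.ρ c.k) 0) b.1 b.2)
      (fun b => A' b.1 b.2))) →
      B8.Prop6Printed d (L : ℝ) (5 * (d : ℝ) * L * inp.B₀) c₁ (fun j => zdCub 𝔸 L (f j)) := by
  obtain ⟨c₁, hc₁, G⟩ := gaugedBoundB8_cubeMember_of_thm4_b9D_d4 (𝔸 := 𝔸) hd2 hL inp hC₂ hcB9 hBbd hBd β len H4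
  refine ⟨c₁, hc₁, fun f S => ?_⟩
  rw [prop6Printed_zdCub_iff]
  intro j α₀ hα U₀ hInA c hs
  exact G (f j).η (f j).hη c (S j c) U₀.1 U₀.2 α₀ hα hInA hs

#print axioms prop6Printed_zdCub_of_thm4_b9D_d4

end Literature.MathematicalPhysics.QuantumFieldTheory.Balaban1983to89.B8Prop6CubeMemberBdry4

end
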